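import Mathlib
import Literature.AlgebraicGeometry.Resolution.BlowupRingChartCoordinates
import Summits.ResolutionOfSingularities.ResolutionOfSingularities.Theorems.RadicialJungCleanModelsCleanLU3CompositePersistPrelims
import HarnessLib

/-!
# Route `RadicialJung`, crux `CleanModels` (stmt-15917), stub `stub_cleanLU3DefectNonDiscrete`, sub-line (C-div): the FIBRE / THREADING
# LEMMA shared by `stub_persistE1` and `stub_persistE2` (workfile `Lines/Sketch_Cdiv_assembly.lean` v3 §PersistV3)

Lead `res-B-lead-1` g5.  OURS; nothing here proves resolution in characteristic `p`.

For a quadratic transform `S ⊂ S'` along `Ō` of a two-dimensional regular local ring `S ⊆ κ`, an r.s.p. `(σ, τ)` of `S` with `σ` of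
minimal value, `w := τ/σ` and the chart ring `B := S[𝔪/σ] = S[w]` (`S' = B_𝔔`, `𝔔` the centre of `Ō`):
* `persistFibre` — a surjective ring map `Φ : B → κ(S)[X]` with `Φ(s) = s̄`, `Φ(w) = X` (kernel `σB`; ✓ `blowupRing_chartQuotient_X`,
  Stacks 0BIQ) and a PRIME `P ∈ κ(S)[X]` with `𝔔 = Φ⁻¹(P)` (so `v(b) < 1 ⟺ P ∣ Φ b`), every element of `S'` a fraction `g/t` with
  `g, t ∈ B`, `v(t) = 1`, and the REDUCTION: `θ − (g/t)^p ∈ 𝔪_{S'}²` ⟹ `P² ∣ Φ(t)^p Φ(θ) − Φ(g)^p` (localisation at `𝔔`: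
  a multiplier `m ∉ 𝔔` with `m·(t^p θ − g^p) ∈ 𝔔²`, then prime avoidance in the PID `κ(S)[X]`).
E1/E2 then finish in `κ(S)[X]` (derivative in `X`, resp. a coefficientwise derivation).
-/

noncomputable section

set_option linter.dupNamespace false -- mandated namespace of this single-conjunct summit

open IsLocalRing Polynomial
open Literature.AlgebraicGeometry.Resolution

namespace Summit.ResolutionOfSingularities.ResolutionOfSingularities.Theorems.RadicialJung.CleanModels

variable {κ : Type} [Field κ]

/-- In a local ring whose maximal ideal is principal, `spanFinrank 𝔪 ≤ 1`. [folklore] -/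
theorem spanFinrank_le_one_of_span_singleton {R : Type*} [CommRing R] [IsLocalRing R] {a : R}
    (h : maximalIdeal R = Ideal.span {a}) : (maximalIdeal R).spanFinrank ≤ 1 := by
  rw [h]
  exact (Submodule.spanFinrank_span_le_ncard_of_finite (Set.toFinite _)).trans (by rw [Set.ncard_singleton])

/-- **The chart map `Φ : S[𝔪/x₀] → κ(S)[X]`** (`s ↦ s̄`, `x₁/x₀ ↦ X`, surjective, kernel `(x₀)`) for a regular system of parameters
`x : Fin 2 → S` of a two-dimensional regular local subring `S ⊆ κ`. [cite: StacksProject, Tag 0BIQ] -/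
theorem exists_chartMap' (S : Subring κ) [IsRegularLocalRing S] (hdim : ringKrullDim S = 2)
    (x : Fin 2 → S) (hx : Ideal.span (Set.range x) = maximalIdeal S) (hx0 : x 0 ≠ 0) :
    ∃ Φ : blowupRing S (x 0 : κ) →+* (ResidueField S)[X], Function.Surjective Φ ∧
      (∀ s : S, Φ ⟨(s : κ), le_blowupRing S (x 0 : κ) s.2⟩ = C (residue S s)) ∧
      (∀ h : ((x 1 : S) : κ) / (x 0 : κ) ∈ blowupRing S (x 0 : κ), Φ ⟨((x 1 : S) : κ) / (x 0 : κ), h⟩ = X) ∧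
      (∀ b : blowupRing S (x 0 : κ), Φ b = 0 ↔
        b ∈ Ideal.span {(⟨(x 0 : κ), le_blowupRing S (x 0 : κ) (x 0).2⟩ : blowupRing S (x 0 : κ))}) := by
  classical
  have hd : (maximalIdeal S).spanFinrank = 2 := by
    have h := IsRegularLocalRing.spanFinrank_maximalIdeal (R := S)
    rw [hdim] at h
    exact_mod_cast h
  obtain ⟨ψ, hbij, hC, hX⟩ := blowupRing_chartQuotient_X S hd x hx 0 hx0
  -- one variable: `MvPolynomial {j // j ≠ 0} ≃ Polynomial`
  haveI : Unique {j : Fin 2 // j ≠ (0 : Fin 2)} :=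
    ⟨⟨⟨1, by decide⟩⟩, fun j => Subtype.ext (by
      rcases j with ⟨j, hj⟩
      change j = 1
      fin_cases j
      · exact absurd rfl hj
      · rfl)⟩
  let ρ := MvPolynomial.uniqueAlgEquiv (ResidueField S) {j : Fin 2 // j ≠ (0 : Fin 2)}
  let ψe := RingEquiv.ofBijective ψ hbij
  let Φ : blowupRing S (x 0 : κ) →+* (ResidueField S)[X] :=
    (ρ.toRingEquiv.toRingHom.comp ψe.symm.toRingHom).comp (Ideal.Quotient.mk _)
  refine ⟨Φ, ?_, ?_, ?_, ?_⟩
  · exact (ρ.toRingEquiv.surjective.comp ψe.symm.surjective).comp Ideal.Quotient.mk_surjective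
  · intro s
    change ρ (ψe.symm (Ideal.Quotient.mk _ _)) = _
    have h1 : Ideal.Quotient.mk _ (⟨(s : κ), le_blowupRing S (x 0 : κ) s.2⟩ : blowupRing S (x 0 : κ)) =
        ψe (MvPolynomial.C (residue S s)) := (hC s).symm
    rw [h1, RingEquiv.symm_apply_apply, MvPolynomial.uniqueAlgEquiv_apply, MvPolynomial.eval₂_C]
  · intro h
    change ρ (ψe.symm (Ideal.Quotient.mk _ _)) = _
    have h1 : Ideal.Quotient.mk _ (⟨((x 1 : S) : κ) / (x 0 : κ), h⟩ : blowupRing S (x 0 : κ)) =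
        ψe (MvPolynomial.X ⟨1, by decide⟩) := (hX ⟨1, by decide⟩ h).symm
    rw [h1, RingEquiv.symm_apply_apply, MvPolynomial.uniqueAlgEquiv_apply, MvPolynomial.eval₂_X]
  · intro b
    change ρ (ψe.symm (Ideal.Quotient.mk _ b)) = 0 ↔ _
    rw [map_eq_zero_iff _ ρ.injective, map_eq_zero_iff _ ψe.symm.injective, Ideal.Quotient.eq_zero_iff_mem]

/-- **The chart map `Φ : S[𝔪/σ] → κ(S)[X]`** (`s ↦ s̄`, `τ/σ ↦ X`, surjective, kernel `(σ)`) for an r.s.p. `(σ, τ)` of a two-dimensional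
regular local subring `S ⊆ κ`. [cite: StacksProject, Tag 0BIQ] -/
theorem exists_chartMap (S : Subring κ) [IsRegularLocalRing S] (hdim : ringKrullDim S = 2)
    (σ τ : S) (hm : maximalIdeal S = Ideal.span {σ, τ}) (hσ0 : (σ : κ) ≠ 0) :
    ∃ Φ : blowupRing S (σ : κ) →+* (ResidueField S)[X], Function.Surjective Φ ∧
      (∀ s : S, Φ ⟨(s : κ), le_blowupRing S (σ : κ) s.2⟩ = C (residue S s)) ∧
      (∀ h : ((τ : S) : κ) / (σ : κ) ∈ blowupRing S (σ : κ), Φ ⟨((τ : S) : κ) / (σ : κ), h⟩ = X) ∧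
      (∀ b : blowupRing S (σ : κ), Φ b = 0 ↔
        b ∈ Ideal.span {(⟨(σ : κ), le_blowupRing S (σ : κ) σ.2⟩ : blowupRing S (σ : κ))}) := by
  have hx : Ideal.span (Set.range ![σ, τ]) = maximalIdeal S := by
    rw [hm]
    congr 1
    ext s
    simp only [Set.mem_range, Set.mem_insert_iff, Set.mem_singleton_iff]
    constructor
    · rintro ⟨i, rfl⟩
      fin_cases i
      · exact Or.inl rfl
      · exact Or.inr rfl
    · rintro (rfl | rfl)
      · exact ⟨0, rfl⟩
      · exact ⟨1, rfl⟩
  have hx0 : (![σ, τ] : Fin 2 → S) 0 ≠ 0 := fun h => hσ0 (by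
    have : σ = 0 := h
    rw [this]; rfl)
  exact exists_chartMap' S hdim ![σ, τ] hx hx0

/-- **The fibre / threading lemma** for one quadratic transform `S ⊂ S'` along `Ō` in dimension two, in the chart `B = S[𝔪/σ]` of the
minimal-value generator `σ` of an r.s.p. `(σ, τ)`: the chart map `Φ : B ↠ κ(S)[X]` (`s ↦ s̄`, `τ/σ ↦ X`), a prime `P` of `κ(S)[X]` with
`v(b) < 1 ⟺ P ∣ Φ(b)` on `B` (the centre of `Ō` on `B` is `Φ⁻¹(P)`; `P ≠ 0` because `S'` is regular of dimension `2`), every element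
of `S'` a fraction `g/t` over `B` with `v(t) = 1`, and the REDUCTION `θ − (g/t)^p ∈ 𝔪_{S'}² ⟹ P² ∣ Φ(t)^p Φ(θ) − Φ(g)^p`.
[folklore] -/
theorem persistFibre (p : ℕ) (Ō : ValuationSubring κ) (S S' : Subring κ) [IsRegularLocalRing S] [IsRegularLocalRing S']
    (hdimS : ringKrullDim S = 2) (hdimS' : ringKrullDim S' = 2)
    (hqt : IsQuadraticTransformAlong Ō S S') (hdom : SubringDominates S Ō.toSubring)
    (σ τ : S) (hm : maximalIdeal S = Ideal.span {σ, τ})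
    (hmax : ∀ z ∈ maximalIdeal S, Ō.valuation (z : κ) ≤ Ō.valuation (σ : κ)) :
    ∃ (_ : blowupRing S (σ : κ) ≤ S') (Φ : blowupRing S (σ : κ) →+* (ResidueField S)[X]) (P : (ResidueField S)[X]),
      Function.Surjective Φ ∧ Prime P ∧
      (∀ s : S, Φ ⟨(s : κ), le_blowupRing S (σ : κ) s.2⟩ = C (residue S s)) ∧
      (∀ h : ((τ : S) : κ) / (σ : κ) ∈ blowupRing S (σ : κ), Φ ⟨((τ : S) : κ) / (σ : κ), h⟩ = X) ∧
      (∀ b : blowupRing S (σ : κ), Ō.valuation (b : κ) < 1 ↔ P ∣ Φ b) ∧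
      (∀ b : blowupRing S (σ : κ), Ō.valuation (b : κ) = 1 ↔ ¬ P ∣ Φ b) ∧
      (∀ z ∈ S', ∃ g ∈ blowupRing S (σ : κ), ∃ t ∈ blowupRing S (σ : κ), Ō.valuation t = 1 ∧ z = g / t) ∧
      (∀ (θ g t : blowupRing S (σ : κ)), Ō.valuation (t : κ) = 1 →
        ∀ hmem : (θ : κ) - ((g : κ) / (t : κ)) ^ p ∈ S',
          (⟨_, hmem⟩ : S') ∈ maximalIdeal S' ^ 2 → P ^ 2 ∣ Φ t ^ p * Φ θ - Φ g ^ p) := by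
  classical
  have hσ0 : (σ : κ) ≠ 0 := by
    intro h
    obtain ⟨_, x, hxm, hx0, -, -⟩ := hqt.exists_eq_locAtCentre
    have h1 := hmax x hxm
    rw [h, map_zero, le_zero_iff, map_eq_zero] at h1
    exact hx0 (Subtype.ext h1)
  have hσm : σ ∈ maximalIdeal S := by rw [hm]; exact Ideal.subset_span (by simp)
  -- `S' = B_𝔔`
  have hS' : S' = locAtCentre (blowupRing S (σ : κ)) Ō := by
    rw [blowupRing_eq_adjoin hm]; exact qt_eq_locAtCentre_adjoin Ō S S' hqt σ τ hm hmax
  have hS'O := hqt.target_le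
  have hdomS' := hqt.dominated
  subst hS'
  set B : Subring κ := blowupRing S (σ : κ) with hB
  have hBS' : B ≤ locAtCentre B Ō := le_locAtCentre B Ō
  have hBŌ : B ≤ Ō.toSubring := hBS'.trans hS'O
  set 𝔔 : Ideal B := subringCentre B Ō hBŌ with h𝔔
  haveI := isLocalization_locAtCentre hBŌ
  -- the chart map
  obtain ⟨Φ, hΦsurj, hΦC, hΦX, hΦker⟩ := exists_chartMap S hdimS σ τ hm hσ0
  have hkerle : RingHom.ker Φ ≤ 𝔔 := by
    intro b hb
    rw [RingHom.mem_ker, hΦker, Ideal.mem_span_singleton] at hb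
    obtain ⟨c, rfl⟩ := hb
    rw [h𝔔, mem_subringCentre_iff, Subring.coe_mul, map_mul]
    have hc : Ō.valuation (c : κ) ≤ 1 := (Ō.valuation_le_one_iff _).mpr (hBŌ c.2)
    have hσlt : Ō.valuation (σ : κ) < 1 := (mem_maximalIdeal_iff_of_dominates hdom σ).mp hσm
    calc Ō.valuation (σ : κ) * Ō.valuation (c : κ) ≤ Ō.valuation (σ : κ) * 1 := mul_le_mul' le_rfl hc
      _ < 1 := by rw [mul_one]; exact hσlt
  -- the image of the centre is a prime of the PID `κ(S)[X]`
  haveI h𝔔' : (𝔔.map Φ).IsPrime := Ideal.map_isPrime_of_surjective hΦsurj hkerle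
  obtain ⟨P, hP⟩ := (IsPrincipalIdealRing.principal (𝔔.map Φ)).principal
  have hP' : 𝔔.map Φ = Ideal.span {P} := hP
  have hcomap : (Ideal.span {P}).comap Φ = 𝔔 := by
    rw [← hP', Ideal.comap_map_of_surjective Φ hΦsurj, sup_eq_left]
    exact fun b hb => hkerle (by rw [RingHom.mem_ker]; exact (Ideal.mem_bot.mp hb))
  have hmem𝔔 : ∀ b : B, b ∈ 𝔔 ↔ P ∣ Φ b := by
    intro b
    rw [← hcomap, Ideal.mem_comap, Ideal.mem_span_singleton]
  have hlt : ∀ b : B, Ō.valuation (b : κ) < 1 ↔ P ∣ Φ b := fun b => by rw [← hmem𝔔, h𝔔, mem_subringCentre_iff]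
  have heq : ∀ b : B, Ō.valuation (b : κ) = 1 ↔ ¬ P ∣ Φ b := by
    intro b
    rw [← hlt]
    have hle : Ō.valuation (b : κ) ≤ 1 := (Ō.valuation_le_one_iff _).mpr (hBŌ b.2)
    constructor
    · intro h; rw [h]; exact lt_irrefl _
    · intro h; exact le_antisymm hle (not_lt.mp h)
  -- `P ≠ 0`: otherwise `𝔔 = σB` and `𝔪_{S'} = (σ)` would be principal, against `dim S' = 2`
  have hmax' : maximalIdeal (locAtCentre B Ō) = 𝔔.map (algebraMap B (locAtCentre B Ō)) :=
    (IsLocalization.AtPrime.map_eq_maximalIdeal 𝔔 (locAtCentre B Ō)).symm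
  have hP0 : P ≠ 0 := by
    intro hP0
    have h𝔔eq : 𝔔 = Ideal.span {(⟨(σ : κ), le_blowupRing S (σ : κ) σ.2⟩ : B)} := by
      apply le_antisymm
      · intro b hb
        rw [← hΦker, ← zero_dvd_iff, ← hP0]; exact (hmem𝔔 b).mp hb
      · rw [Ideal.span_singleton_le_iff_mem, h𝔔, mem_subringCentre_iff]
        exact (mem_maximalIdeal_iff_of_dominates hdom σ).mp hσm
    have hprinc : maximalIdeal (locAtCentre B Ō) =
        Ideal.span {algebraMap B (locAtCentre B Ō) ⟨(σ : κ), le_blowupRing S (σ : κ) σ.2⟩} := by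
      rw [hmax', h𝔔eq, Ideal.map_span, Set.image_singleton]
    have h1 := spanFinrank_le_one_of_span_singleton hprinc
    have h2 := IsRegularLocalRing.spanFinrank_maximalIdeal (R := locAtCentre B Ō)
    rw [hdimS'] at h2
    have h3 : (maximalIdeal (locAtCentre B Ō)).spanFinrank = 2 := by exact_mod_cast h2
    omega
  have hPprime : Prime P := (Ideal.span_singleton_prime hP0).mp (hP' ▸ h𝔔')
  -- fractions
  have hfrac : ∀ z ∈ locAtCentre B Ō, ∃ g ∈ B, ∃ t ∈ B, Ō.valuation t = 1 ∧ z = g / t :=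
    fun z hz => mem_locAtCentre_iff.mp hz
  refine ⟨hBS', Φ, P, hΦsurj, hPprime, hΦC, hΦX, hlt, heq, hfrac, ?_⟩
  -- the reduction
  intro θ g t ht hmem hsq
  have ht0 : (t : κ) ≠ 0 := ne_zero_of_valuation_eq_one ht
  have ht𝔔 : t ∉ 𝔔 := by rw [h𝔔, mem_subringCentre_iff, ht]; exact lt_irrefl _
  set xB : B := t ^ p * θ - g ^ p with hxB
  -- `algebraMap xB = t^p · (θ − (g/t)^p) ∈ 𝔪'^2`
  have halg : algebraMap B (locAtCentre B Ō) xB =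
      (algebraMap B (locAtCentre B Ō) t) ^ p * ⟨_, hmem⟩ := by
    apply Subtype.ext
    change ((t : κ) ^ p * θ - (g : κ) ^ p) = (t : κ) ^ p * ((θ : κ) - ((g : κ) / (t : κ)) ^ p)
    rw [div_pow, mul_sub, mul_div_cancel₀ _ (pow_ne_zero _ ht0)]
  have hxmem : algebraMap B (locAtCentre B Ō) xB ∈ (𝔔 ^ 2).map (algebraMap B (locAtCentre B Ō)) := by
    rw [Ideal.map_pow, ← hmax', halg]
    exact Ideal.mul_mem_left _ _ hsq
  obtain ⟨m, hm𝔔, hmx⟩ := (IsLocalization.algebraMap_mem_map_algebraMap_iff 𝔔.primeCompl (locAtCentre B Ō) (𝔔 ^ 2) xB).mp hxmem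
  have hm' : ¬ P ∣ Φ m := fun h => hm𝔔 ((hmem𝔔 m).mpr h)
  have hΦmx : P ^ 2 ∣ Φ m * Φ xB := by
    rw [← map_mul, ← Ideal.mem_span_singleton, ← Ideal.span_singleton_pow, ← hP', ← Ideal.map_pow]
    exact Ideal.mem_map_of_mem Φ hmx
  have := hPprime.pow_dvd_of_dvd_mul_left 2 hm' hΦmx
  simpa [hxB, map_sub, map_mul, map_pow] using this

end Summit.ResolutionOfSingularities.ResolutionOfSingularities.Theorems.RadicialJung.CleanModels

end
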